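import Summits.AtomisticToContinuum.FouriersLaw.Theses.BondHeatUncertainty
import Summits.AtomisticToContinuum.FouriersLaw.Theorems.LinearResponseFTUR.Negative.KZeroCorner
import Summits.AtomisticToContinuum.FouriersLaw.Theorems.LinearResponseFTUR.Negative.ShapeConstraints
import Literature.MathematicalPhysics.KineticTheory.LangevinChainKernel
import Literature.MathematicalPhysics.KineticTheory.LangevinChainGibbs
import Literature.MathematicalPhysics.KineticTheory.LangevinChainNESSProofs
import Literature.MathematicalPhysics.KineticTheory.LangevinChainNESSFromH2
import Literature.MathematicalPhysics.KineticTheory.LangevinChainKernelDensity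
import Literature.MathematicalPhysics.KineticTheory.LangevinChainTheorem51
import Literature.Probability.Entropy.FluctuationTheoremUncertainty

/-!
# Line `counting-field-detailed-balance` — skeleton for the crux `BondHeatUncertainty.LinearResponseFTUR` (★)
(crux item stmt-AtomisticToContinuum-9122, rank 4, the engine of route BondHeatUncertainty, FIXED `N`;
planner crux-plan seat `cruxplan-stmt-AtomisticToContinuum-9122-counting-field-detai`, round 1)

THE LINE (idea card `Cruxes/LinearResponseFTUR/Ideas/counting-field-detailed-balance.md`, triage r1: pass ×3).
Adjoin the bond charge `Q_t = ∫₀ᵗ j_b(x_s) ds` as a coordinate. Started from LEBESGUE measure `dx`, the law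
`M_t(dx, dy, dQ)` of `(x_0, x_t, Q_t)` of the two-temperature chain satisfies LOCAL DETAILED BALANCE AS A
ONE-STEP KERNEL IDENTITY on the finite-dimensional space `PhaseSpace N × PhaseSpace N × ℝ`:
`dM_t / d(ι_* M_t) = exp(s_med)`, `ι(x, y, Q) = (Θy, Θx, -Q)`, `Θ(q,p) = (q,-p)`,
`s_med = V₂(x) - V₂(y) - Q (1/T_L - 1/T_R)`, `V₂ = H_{≤b}/T_L + H_{>b}/T_R` (bond-`b` spring split half/half)
— `stub_countingFieldDB`, the lever (no path space, no Girsanov: kernel duality with constant Jacobian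
`e^{-2γt}` + pathwise momentum reversal + the Doob conjugation `L̃⁺ = e^{-Ṽ} L̃ e^{Ṽ} - 2γ` on the
charge-extended space, where the counting-field term `∂_Q` cancels the Liouville transfer exactly).
Consequences, each a registered stub of this file:
* `stub_stationaryFTUR` : LDB ⇒ for every probability measure `μ` INVARIANT under the constructed kernels,
  with an exponential moment, a density of finite entropy and `KL(μ ‖ Θ_*μ) < ∞`, the law `P` of
  `(x_0, x_t, Q_t)` under the stationary chain has `P ~ ι_*P` (NO positivity of the density is needed: for an
  involution `P ≪ ι_*P ⟺ ι_*P ≪ P`, and `P ≪ ι_*P` is invariance + a.e. `Θ`-symmetry of `{ρ > 0}`),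
  `llr = log ρ(x) - log ρ(Θy) + s_med` with `⟨llr⟩ = KL(μ‖Θ_*μ) + t⟨j_b⟩_μ(1/T_R - 1/T_L)` EXACTLY, `Q_t` is
  `ι`-odd and `L²`; the vendored-and-proved `Literature.Probability.Entropy.HasegawaVanVu2019_FTUR` then gives
  the finite-bias FTUR `⟨Q_t⟩² ≤ ½ Var(Q_t) (e^{⟨llr⟩} - 1)` and `⟨Q_t⟩ = t ⟨j_b⟩_μ`.
* `stub_finiteEntropy` : every invariant probability measure of the constructed kernels with an exponential
  moment has finite differential entropy `log ρ ∈ L¹(μ)` (the ONLY density fact the line needs; the lower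
  half is the exponential moment, the upper half `∫ρ log⁺ρ < ∞` is the content).
* `stub_equalBondCurrents` : in a weak steady state with an exponential moment all mean bond currents are
  equal, `⟨j_b⟩ = totalCurrent/(N-1)` (site-energy balance tested against `C_c^∞` cut-offs; 0717-level input).
* `stub_varianceLimit` : `Var_δ(Q_t) → V_N(b,t)` as `δ → 0` (the crux's `V`, verbatim): Gibbs-invariance +
  Markov property at `δ = 0` and `δ`-continuity of the NESS and of the flow in the bath amplitudes.
* `stub_localClausius` : LDB ⇒ the second law at finite bias, PER BOND, under weak-NESS uniqueness (U):
  `(1/T_R - 1/T_L) ⟨j_i⟩_{μ_{N,T_L,T_R}} ≥ 0` — LDB with the local-equilibrium start `ν ∝ e^{-V₂}` gives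
  `llr = -(1/T_L - 1/T_R) Q_t` POINTWISE (transient Evans–Searles), `KL ≥ 0`, then Cesàro ergodicity
  (Krylov–Bogoliubov tightness from (3.4) + Feller + (U)) identifies `E_ν Q_t / t → ⟨j_b⟩_δ`. This yields
  clause (a) with NO density hypothesis at all (covering `K_N = ∞`, as `fturShape_nonneg` demands).
`LinearResponseFTUR_of` composes the six stubs into the crux BY NAME with a real proof: the NESS facts the
stubs consume (kernel-invariance of `μ_δ`, exponential moments, `μ_δ ≪ Leb`) are DERIVED here from (U) and
the tree (`pinnedChainSemigroup_exists_isInvariant_of_pos`, `pinnedChain_isSteadyState_of_isInvariant`,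
`pinnedChain_transitionKernel_one_absolutelyContinuous`, `IsInvariant.absolutelyContinuous_of_kernel`);
clause (a) is `stub_localClausius` summed over bonds; clause (b) is the `δ → 0` bookkeeping certificate of
the standing disprover (`Disproof.lean` §7 `fturShape_pointwise_of_hvv_family`, re-proved below so that this
file does not import the disprover's work file) fed with `stub_stationaryFTUR` (at each small `δ ≠ 0`, using
the crux's OWN hypothesis `KL ≤ Kδ²` for `KL < ∞`), `stub_equalBondCurrents` (`⟨Q_t⟩_δ/δ → G t`),
`stub_varianceLimit`, and `KL.toReal ≤ Kδ²`.

DISPROOF USED (`Cruxes/LinearResponseFTUR/Disproof.lean`, cycles 1–2): `fturShape_false_without_K` — honoured: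
`K` enters at `stub_stationaryFTUR`'s exponent (`KL(μ_δ‖Θμ_δ)` is kept, never dropped) and is consumed in
`_of` only as `KL.toReal ≤ Kδ²`; `not_fturShape_two_add` / `fturShape_memory_le` — the constant is exactly 2:
HVV is applied ONCE (n = 1) with `⟨llr⟩ = σ_δ t + KL` EXACTLY (no inequality spent before HVV, no
data-processing loss: the path density is `σ(x_0,x_t,Q_t)`-measurable); `fturShape_nonneg` — (a) is obtained
independently of (b); `fturShape_eq_zero_of_nonpos` — `V_N(b,t)` is reached as a limit of genuine variances
(`stub_varianceLimit` carries the interval-integrability of `s ↦ C_N(b,s)`); `response_eq_zero_of_klDiv_zero`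
/ landed `Negative/KZeroCorner` — consistent (`K = 0` admissible ⇒ `D_N = 0`, both sides `0`); landed
`Negative/ShapeConstraints` — no stub is an instance of `not_shape_K_zero` / `not_shape_two_add` (imported and
checked: the stubs never state a shape inequality; only `_of` produces the crux's exact shape). §9 pre-screen
and all three triagers re-derived the sign/direction of `stub_countingFieldDB` (weight
`exp(V₂(X) - V₂(x) + Q(1/T_L - 1/T_R))` on `F ∘ ι`; at `T_L = T_R` it is Θ-detailed balance of Gibbs).
-/

set_option linter.dupNamespace false
set_option linter.unusedVariables false

noncomputable section

open MeasureTheory ProbabilityTheory Filter Topology Set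
open scoped NNReal ENNReal BigOperators
open Literature.MathematicalPhysics.KineticTheory.HeatConduction Literature.Probability.Process
open Summit.AtomisticToContinuum.FouriersLaw.Theses.BondHeatUncertainty

namespace Summit.AtomisticToContinuum.FouriersLaw.Cruxes.LinearResponseFTUR.CountingFieldDetailedBalance

/-! ## The six stub statements (self-contained `Prop`s over tree declarations; `let`s as in the crux) -/

/-- **S1 — counting-field local detailed balance (the lever; all `T_L, T_R`, fixed `N`, no path space).**
For the pinned chain `P`, a bond `b` (`b+1 < N`) and `t > 0`, with `Θ(q,p) = (q,-p)`, `j = j_b` the bond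
current, `Hl = H_{≤b}` the energy of the sites `≤ b` with the bond-`b` spring counted HALF (so that the
Liouville operator gives `A Hl = -j_b`, matching `j_b = -½(p_b+p_{b+1})V'`), `V₂ = Hl/T_L + (H - Hl)/T_R`,
`X = x_t = Φ_t(x, B(w))` the pathwise solution (`OscillatorChain.solMap`) and `Q = ∫₀ᵗ j_b(x_s) ds` the charge
through bond `b`: for every measurable `F ≥ 0` on `PhaseSpace N × PhaseSpace N × ℝ`,
`∫dx E_x F(x, x_t, Q_t) = ∫dx E_x [F(Θx_t, Θx, -Q_t) · exp(V₂(x_t) - V₂(x) + Q_t (1/T_L - 1/T_R))]`,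
i.e. `dM_t = e^{s_med} d(ι_*M_t)` for the Lebesgue-started law `M_t` of `(x_0, x_t, Q_t)`,
`ι(x,y,Q) = (Θy,Θx,-Q)`, `s_med = -q_L/T_L - q_R/T_R` through `q_L = ΔH_{≤b} + Q_t`, `q_R = ΔH_{>b} - Q_t`.
At `T_L = T_R` it is Θ-detailed balance of the constructed kernel w.r.t. Gibbs. Proof plan (card): kernel
duality `dξ P̃_t(ξ,dη) = e^{2γt} dη P̃^{-Ỹ}_t(η,dξ)` for the charge-extended drift `Ỹ = (Y, j_b)` (constant
divergence `-2γ`, fibre-translation invariant; extension of the tree's `ConfinedDuality` /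
`IsConfining.compProd_langevinKernel_eq`), pathwise reversal `P̃^{-Ỹ} = Θ̂ P̃⁺ Θ̂`, and the Doob conjugation
`L̃⁺ = e^{-Ṽ} L̃ e^{Ṽ} - 2γ`, `Ṽ(x,Q) = V₂(x) + (1/T_L - 1/T_R)Q`, lifted to the semigroups by the exact
Lyapunov identity `L̃ e^{θṼ} = θγ e^{θṼ} Σ_b (1 - (1-θ)p_b²/T_b)` and uniqueness for the anti-damped Cauchy
problem. (Verbatim the card's first lemma `SketchIdeator1.CountingFieldDetailedBalance`, rc 0.) -/
def CountingFieldDB : Prop :=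
  ∀ ω₂ lam β γ : ℝ, 0 < ω₂ → 0 < lam → 0 < β → 0 < γ → ∀ T_L T_R : ℝ, 0 < T_L → 0 < T_R →
    (let P := pinnedChain ω₂ lam β γ
     ∀ N : ℕ, ∀ b : ℕ, b + 1 < N → ∀ t : ℝ, 0 < t →
     let Θ : PhaseSpace N → PhaseSpace N := fun x => (x.1, -x.2)
     let j : PhaseSpace N → ℝ := fun x => if h : b < N then P.bondCurrent N ⟨b, h⟩ x else 0
     let Hl : PhaseSpace N → ℝ := fun x =>
       (∑ i : Fin N, if i.val ≤ b then x.2 i ^ 2 / 2 + P.U (x.1 i) else 0) +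
         ∑ i : Fin N, ∑ k : Fin N, if k.val = i.val + 1 then
           (if k.val ≤ b then P.V (x.1 k - x.1 i) else if i.val = b then P.V (x.1 k - x.1 i) / 2 else 0)
           else 0
     let V₂ : PhaseSpace N → ℝ := fun x => Hl x / T_L + (P.hamiltonian N x - Hl x) / T_R
     let X : PhaseSpace N → WienerPair → PhaseSpace N := fun x w => P.solMap N T_L T_R t x (pairPath w)
     let Q : PhaseSpace N → WienerPair → ℝ := fun x w =>
       ∫ s in (0 : ℝ)..t, j (P.solMap N T_L T_R s x (pairPath w))
     ∀ F : PhaseSpace N × PhaseSpace N × ℝ → ℝ≥0∞, Measurable F →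
       ∫⁻ x, ∫⁻ w, F (x, X x w, Q x w) ∂wienerPair ∂volume =
         ∫⁻ x, ∫⁻ w, F (Θ (X x w), Θ x, -Q x w) *
           ENNReal.ofReal (Real.exp (V₂ (X x w) - V₂ x + Q x w * (1 / T_L - 1 / T_R))) ∂wienerPair ∂volume)

/-- **S2 — the finite-bias (stationary) fluctuation-theorem uncertainty relation.** For the pinned chain at
bath temperatures `T_L, T_R > 0`, a bond `b` (`b+1 < N`) and a probability measure `μ` on phase space that is
INVARIANT under the constructed transition kernels, has an exponential moment `e^{ϑH} ∈ L¹(μ)`, is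
absolutely continuous with density `ρ = dμ/dLeb` of finite entropy `log ρ ∈ L¹(μ)`, and has finite snapshot
irreversibility `KL(μ ‖ Θ_*μ) < ∞`: for every `t > 0`, with `Q_t(x,w) = ∫₀ᵗ j_b(Φ_s(x,B(w))) ds` under
`μ ⊗ Wiener`, (i) `⟨Q_t⟩ = t ⟨j_b⟩_μ` (Fubini + invariance) and (ii) Hasegawa–Van Vu
`⟨Q_t⟩² ≤ ½ Var(Q_t) (exp(t ⟨j_b⟩_μ (1/T_R - 1/T_L) + KL(μ‖Θ_*μ)) - 1)`.
Route: S1 gives `P ~ ι_*P` for the law `P` of `(x_0,x_t,Q_t)` and `llr = log ρ(x_0) - log ρ(Θx_t) + s_med`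
pointwise; integrability from `log ρ ∈ L¹(μ)`, `llr(μ,Θ_*μ) ∈ L¹(μ)`, `V₂ ≤ H(1/T_L+1/T_R)`, `Q_t ∈ L²`;
`⟨llr⟩` by invariance; then `Literature.Probability.Entropy.HasegawaVanVu2019_FTUR_holds` with `φ = Q`
(exactly `ι`-odd) on `PhaseSpace N × PhaseSpace N × ℝ`. -/
def StationaryFTUR : Prop :=
  ∀ ω₂ lam β γ : ℝ, 0 < ω₂ → 0 < lam → 0 < β → 0 < γ → ∀ T_L T_R : ℝ, 0 < T_L → 0 < T_R →
    (let P := pinnedChain ω₂ lam β γ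
     ∀ N : ℕ, ∀ b : ℕ, b + 1 < N → ∀ μ : Measure (PhaseSpace N), IsProbabilityMeasure μ →
     (∀ u : ℝ≥0, μ.bind (P.transitionKernel N T_L T_R u) = μ) →
     (∃ ϑ : ℝ, 0 < ϑ ∧ Integrable (fun x => Real.exp (ϑ * P.hamiltonian N x)) μ) →
     μ ≪ (volume : Measure (PhaseSpace N)) →
     Integrable (fun x => Real.log (μ.rnDeriv volume x).toReal) μ →
     InformationTheory.klDiv μ (μ.map fun x : PhaseSpace N => (x.1, -x.2)) ≠ ⊤ →
     let j : PhaseSpace N → ℝ := fun x => if h : b < N then P.bondCurrent N ⟨b, h⟩ x else 0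
     ∀ t : ℝ, 0 < t →
     let Q : PhaseSpace N × WienerPair → ℝ := fun p =>
       ∫ s in (0 : ℝ)..t, j (P.solMap N T_L T_R s p.1 (pairPath p.2))
     (∫ p, Q p ∂(μ.prod wienerPair) = t * ∫ x, j x ∂μ) ∧
     (∫ p, Q p ∂(μ.prod wienerPair)) ^ 2 ≤
       1 / 2 * variance Q (μ.prod wienerPair) *
         (Real.exp (t * (∫ x, j x ∂μ) * (1 / T_R - 1 / T_L) +
            (InformationTheory.klDiv μ (μ.map fun x : PhaseSpace N => (x.1, -x.2))).toReal) - 1))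

/-- **S3 — finite entropy of the steady state (the only density fact the line needs).** For the pinned chain
(`N ≥ 2`, `T_L, T_R > 0`), every probability measure invariant under the constructed transition kernels and
integrating some `e^{ϑH}` has a Lebesgue density `ρ = dμ/dLeb` with `log ρ ∈ L¹(μ)` (absolute continuity
itself is a theorem of the tree: `P_1(z,·) ≪ Leb` + invariance). Lower half `∫ρ log⁻ρ`: Gibbs variational
bound from the exponential moment; upper half `∫ρ log⁺ρ < ∞`: e.g. `ρ = ∫ μ(dz) p_1(z,·)` with a bound
`sup_y p_1(z,y) ≤ C e^{ϑH(z)}` on the (hypoelliptic, CEHR Prop. 3.2) time-one transition density. -/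
def FiniteEntropy : Prop :=
  ∀ ω₂ lam β γ : ℝ, 0 < ω₂ → 0 < lam → 0 < β → 0 < γ → ∀ T_L T_R : ℝ, 0 < T_L → 0 < T_R →
    (let P := pinnedChain ω₂ lam β γ
     ∀ N : ℕ, 2 ≤ N → ∀ μ : Measure (PhaseSpace N), IsProbabilityMeasure μ →
     (∀ u : ℝ≥0, μ.bind (P.transitionKernel N T_L T_R u) = μ) →
     (∃ ϑ : ℝ, 0 < ϑ ∧ Integrable (fun x => Real.exp (ϑ * P.hamiltonian N x)) μ) →
     Integrable (fun x => Real.log (μ.rnDeriv volume x).toReal) μ)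

/-- **S4 — equal mean bond currents in a steady state.** For the pinned chain and every weak steady state
`μ` (`OscillatorChain.IsSteadyState`: `∫ L f dμ = 0` on `C_c^∞`) with an exponential moment, every bond
`b` with `b+1 < N` carries the mean current `⟨j_b⟩_μ = totalCurrent(μ)/(N-1)` (site-energy balance
`L e_i = j_{i-1} - j_i` for the interior sites, tested against `e_i χ_R(H)` and `R → ∞` by dominated
convergence; the last `bondCurrent` is `0`). 0717-level input, no uniqueness needed. -/
def EqualBondCurrents : Prop :=
  ∀ ω₂ lam β γ : ℝ, 0 < ω₂ → 0 < lam → 0 < β → 0 < γ → ∀ T_L T_R : ℝ, 0 < T_L → 0 < T_R →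
    (let P := pinnedChain ω₂ lam β γ
     ∀ N : ℕ, ∀ μ : Measure (PhaseSpace N), P.IsSteadyState N T_L T_R μ →
     (∃ ϑ : ℝ, 0 < ϑ ∧ Integrable (fun x => Real.exp (ϑ * P.hamiltonian N x)) μ) →
     ∀ b : ℕ, b + 1 < N →
     let j : PhaseSpace N → ℝ := fun x => if h : b < N then P.bondCurrent N ⟨b, h⟩ x else 0
     ∫ x, j x ∂μ = P.totalCurrent μ / ((N : ℝ) - 1))

/-- **S5 — the bond-charge variance at small bias is the equilibrium bond-heat variance of the crux.** Under
weak-NESS uniqueness, along any steady-state family `μ`, for `T > 0`, `N ≥ 2`, a bond `b` and `t > 0`: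
`Var_{μ_{N,T+δ/2,T-δ/2} ⊗ Wiener}(Q_t) → V_N(b,t) = 2∫₀ᵗ (t-s) C_N(b,s) ds` as `δ → 0`, `δ ≠ 0`, with `C`, `V`
VERBATIM the crux's (`transitionKernel N T T`, `gibbsMeasure N T`). Content: at `δ = 0` the unique steady
state is Gibbs (`pinnedChain_isSteadyState_gibbsMeasure` + (U)), which is therefore invariant under the
constructed kernels; Markov property + Fubini + `⟨j_b⟩_T = 0` give `Var_eq(Q_t) = 2∫₀ᵗ(t-s)C(s)ds` (with the
interval-integrability of `s ↦ C_N(b,s)` that `fturShape_eq_zero_of_nonpos` demands); `δ`-continuity from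
tightness (uniform `e^{ϑH}` moments), (U), and Lipschitz dependence of the flow on the noise amplitudes
(`LangevinChainNoiseContinuity`). -/
def BondChargeVarianceLimit : Prop :=
  ∀ ω₂ lam β γ : ℝ, 0 < ω₂ → 0 < lam → 0 < β → 0 < γ →
    (∀ (N : ℕ) (T_L T_R : ℝ), 0 < T_L → 0 < T_R → ∀ μ ν : Measure (PhaseSpace N),
      (pinnedChain ω₂ lam β γ).IsSteadyState N T_L T_R μ →
      (pinnedChain ω₂ lam β γ).IsSteadyState N T_L T_R ν → μ = ν) →
    ∀ μ : (N : ℕ) → ℝ → ℝ → Measure (PhaseSpace N),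
      (∀ (N : ℕ) (T_L T_R : ℝ), 0 < T_L → 0 < T_R →
        (pinnedChain ω₂ lam β γ).IsSteadyState N T_L T_R (μ N T_L T_R)) →
    ∀ T : ℝ, 0 < T →
    (let P := pinnedChain ω₂ lam β γ
     let C : ℕ → ℕ → ℝ → ℝ := fun N b s => if h : b < N then ∫ z, P.bondCurrent N ⟨b, h⟩ z * (∫ y, P.bondCurrent N ⟨b, h⟩ y ∂(P.transitionKernel N T T s.toNNReal z)) ∂(P.gibbsMeasure N T) else 0
     let V : ℕ → ℕ → ℝ → ℝ := fun N b t => 2 * ∫ s in (0 : ℝ)..t, (t - s) * C N b s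
     ∀ N : ℕ, 2 ≤ N → ∀ b : ℕ, b + 1 < N → ∀ t : ℝ, 0 < t →
     let j : PhaseSpace N → ℝ := fun x => if h : b < N then P.bondCurrent N ⟨b, h⟩ x else 0
     Tendsto (fun δ : ℝ =>
       variance (fun p : PhaseSpace N × WienerPair =>
         ∫ s in (0 : ℝ)..t, j (P.solMap N (T + δ / 2) (T - δ / 2) s p.1 (pairPath p.2)))
         ((μ N (T + δ / 2) (T - δ / 2)).prod wienerPair))
       (𝓝[≠] 0) (𝓝 (V N b t)))

/-- **S6 — the second law at finite bias, per bond.** Under weak-NESS uniqueness, along any steady-state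
family, for every `N`, `T_L, T_R > 0` and every bond index `i`:
`(1/T_R - 1/T_L) · ⟨j_i⟩_{μ_{N,T_L,T_R}} ≥ 0` (heat flows from hot to cold on average; the last index carries
`j ≡ 0`). Route (this line, no NESS density fact): S1 with the local-equilibrium start `ν ∝ e^{-V₂}`
(a probability measure, `V₂ ≥ H/max T`) gives the transient fluctuation theorem `llr(P^ν, ι_*P^ν) = -(1/T_L -
1/T_R) Q_t` POINTWISE, hence `(1/T_R - 1/T_L) E_ν Q_t = KL ≥ 0` for all `t`; Cesàro ergodicity
`E_ν Q_t / t = t⁻¹∫₀ᵗ νP_s(j_b) ds → ⟨j_b⟩_δ` (tightness from (3.4), Feller, every Cesàro limit point is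
kernel-invariant with an exponential moment hence a weak steady state
(`pinnedChain_isSteadyState_of_isInvariant`), hence `= μ_δ` by (U)). -/
def SecondLawAtFiniteBias : Prop :=
  ∀ ω₂ lam β γ : ℝ, 0 < ω₂ → 0 < lam → 0 < β → 0 < γ →
    (∀ (N : ℕ) (T_L T_R : ℝ), 0 < T_L → 0 < T_R → ∀ μ ν : Measure (PhaseSpace N),
      (pinnedChain ω₂ lam β γ).IsSteadyState N T_L T_R μ →
      (pinnedChain ω₂ lam β γ).IsSteadyState N T_L T_R ν → μ = ν) →
    ∀ μ : (N : ℕ) → ℝ → ℝ → Measure (PhaseSpace N),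
      (∀ (N : ℕ) (T_L T_R : ℝ), 0 < T_L → 0 < T_R →
        (pinnedChain ω₂ lam β γ).IsSteadyState N T_L T_R (μ N T_L T_R)) →
    ∀ (N : ℕ) (T_L T_R : ℝ), 0 < T_L → 0 < T_R → ∀ i : Fin N,
      0 ≤ (1 / T_R - 1 / T_L) * ∫ x, (pinnedChain ω₂ lam β γ).bondCurrent N i x ∂(μ N T_L T_R)

/-! ## Registered stubs (the open obligations of the line; `sorry` lives only here) -/

namespace Registered

/-- Alias of `CountingFieldDB` keyed by the registered stub name. -/
abbrev stub_countingFieldDB : Prop := CountingFieldDB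
/-- Alias of `CountingFieldDB → StationaryFTUR` keyed by the registered stub name. -/
abbrev stub_stationaryFTUR : Prop := CountingFieldDB → StationaryFTUR
/-- Alias of `FiniteEntropy` keyed by the registered stub name. -/
abbrev stub_finiteEntropy : Prop := FiniteEntropy
/-- Alias of `EqualBondCurrents` keyed by the registered stub name. -/
abbrev stub_equalBondCurrents : Prop := EqualBondCurrents
/-- Alias of `BondChargeVarianceLimit` keyed by the registered stub name. -/
abbrev stub_varianceLimit : Prop := BondChargeVarianceLimit
/-- Alias of `CountingFieldDB → SecondLawAtFiniteBias` keyed by the registered stub name. -/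
abbrev stub_localClausius : Prop := CountingFieldDB → SecondLawAtFiniteBias

end Registered

/-- STUB S1 (HARDEST — the lever, L): counting-field local detailed balance as a one-step kernel identity. -/
theorem stub_countingFieldDB : CountingFieldDB := by
  sorry

/-- STUB S2 (L, measure theory on `PhaseSpace² × ℝ` + the proved HVV fact): LDB ⇒ finite-bias FTUR for
kernel-invariant measures of finite entropy. -/
theorem stub_stationaryFTUR : CountingFieldDB → StationaryFTUR := by
  sorry

/-- STUB S3 (M/L, NESS regularity): finite entropy of invariant probability measures with an exponential
moment. -/
theorem stub_finiteEntropy : FiniteEntropy := by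
  sorry

/-- STUB S4 (M, 0717-level): equal mean bond currents in weak steady states with an exponential moment. -/
theorem stub_equalBondCurrents : EqualBondCurrents := by
  sorry

/-- STUB S5 (L, shared with every finite-`δ` line): `Var_δ(Q_t) → V_N(b,t)`. -/
theorem stub_varianceLimit : BondChargeVarianceLimit := by
  sorry

/-- STUB S6 (M/L): LDB ⇒ second law per bond at finite bias (transient FT from the local-equilibrium start +
Cesàro ergodicity under (U)). -/
theorem stub_localClausius : CountingFieldDB → SecondLawAtFiniteBias := by
  sorry

/-! ## Proved glue, part 1: the `δ → 0` bookkeeping (re-proof of Disproof §7, standing disprover cycle 2) -/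

/-- Carnot factor algebra: `1/(T - δ/2) - 1/(T + δ/2) = δ / (T² - δ²/4)`. -/
theorem inv_sub_inv_temperatures {T δ : ℝ} (h₁ : T - δ / 2 ≠ 0) (h₂ : T + δ / 2 ≠ 0) :
    1 / (T - δ / 2) - 1 / (T + δ / 2) = δ / (T ^ 2 - δ ^ 2 / 4) := by
  have h3 : T ^ 2 - δ ^ 2 / 4 = (T - δ / 2) * (T + δ / 2) := by ring
  rw [h3, div_sub_div _ _ h₁ h₂]
  congr 1
  ring

/-- `exp x - 1 ≤ x · exp x` for every real `x`. -/
theorem exp_sub_one_le_mul_exp (x : ℝ) : Real.exp x - 1 ≤ x * Real.exp x := by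
  have h := Real.add_one_le_exp (-x)
  have hx := Real.exp_pos x
  have : Real.exp (-x) * Real.exp x = 1 := by rw [← Real.exp_add]; simp
  nlinarith

/-- Small `δ ≠ 0` have both bath temperatures `T ± δ/2` positive. -/
theorem eventually_small_bias {T : ℝ} (hT : 0 < T) :
    ∀ᶠ δ in 𝓝[≠] (0 : ℝ), (δ ∈ Set.Ioo (-T) T ∧ δ ≠ 0) ∧ 0 < T + δ / 2 ∧ 0 < T - δ / 2 := by
  have h1 : ∀ᶠ δ in 𝓝 (0 : ℝ), δ ∈ Set.Ioo (-T) T := Ioo_mem_nhds (by linarith) hT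
  have h1' : ∀ᶠ δ in 𝓝[≠] (0 : ℝ), δ ∈ Set.Ioo (-T) T := mem_nhdsWithin_of_mem_nhds h1
  have h2' : ∀ᶠ δ in 𝓝[≠] (0 : ℝ), δ ≠ 0 := self_mem_nhdsWithin
  filter_upwards [h1', h2'] with δ hδ hne
  obtain ⟨hlo, hhi⟩ := hδ
  exact ⟨⟨⟨hlo, hhi⟩, hne⟩, by linarith, by linarith⟩

/-- **Bookkeeping certificate (the `δ → 0` step; = Disproof §7 `fturShape_pointwise_of_hvv_family`).** At one
bond, one `t > 0`: from HVV at each small `δ`, `v ≥ 0`, `m δ/δ → G t`, `v δ → V` and the entropy balance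
`s δ ≤ (m δ/t)(1/(T-δ/2) - 1/(T+δ/2)) t + K δ²` one gets EXACTLY `2 G² t² ≤ V (G t/T² + K)`. -/
theorem shape_pointwise_of_hvv_family {m v s : ℝ → ℝ} {G T K V t : ℝ} (ht : 0 < t)
    (hT : 0 < T)
    (hHVV : ∀ᶠ δ in 𝓝[≠] (0 : ℝ), m δ ^ 2 ≤ 1 / 2 * v δ * (Real.exp (s δ) - 1))
    (hv0 : ∀ᶠ δ in 𝓝[≠] (0 : ℝ), 0 ≤ v δ)
    (hm : Tendsto (fun δ => m δ / δ) (𝓝[≠] 0) (𝓝 (G * t)))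
    (hv : Tendsto v (𝓝[≠] 0) (𝓝 V))
    (hs : ∀ᶠ δ in 𝓝[≠] (0 : ℝ),
      s δ ≤ m δ / t * (1 / (T - δ / 2) - 1 / (T + δ / 2)) * t + K * δ ^ 2) :
    2 * G ^ 2 * t ^ 2 ≤ V * (G * t / T ^ 2 + K) := by
  -- the entropy bound is δ² · w δ with w δ → G t / T² + K
  set w : ℝ → ℝ := fun δ => m δ / δ / (T ^ 2 - δ ^ 2 / 4) + K with hw_def
  have hI : ∀ᶠ δ in 𝓝[≠] (0 : ℝ), δ ∈ Set.Ioo (-T) T ∧ δ ≠ 0 :=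
    (eventually_small_bias hT).mono fun δ h => h.1
  have hden : Tendsto (fun δ : ℝ => T ^ 2 - δ ^ 2 / 4) (𝓝[≠] 0) (𝓝 (T ^ 2)) := by
    have : Tendsto (fun δ : ℝ => T ^ 2 - δ ^ 2 / 4) (𝓝 0) (𝓝 (T ^ 2 - 0 ^ 2 / 4)) :=
      ((continuous_const.sub ((continuous_pow 2).div_const 4)).tendsto 0)
    simpa using this.mono_left nhdsWithin_le_nhds
  have hw : Tendsto w (𝓝[≠] 0) (𝓝 (G * t / T ^ 2 + K)) :=
    (hm.div hden (by positivity)).add tendsto_const_nhds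
  have hsq : Tendsto (fun δ : ℝ => δ ^ 2) (𝓝[≠] 0) (𝓝 0) := by
    have : Tendsto (fun δ : ℝ => δ ^ 2) (𝓝 0) (𝓝 (0 ^ 2)) := (continuous_pow 2).tendsto 0
    simpa using this.mono_left nhdsWithin_le_nhds
  have hx : Tendsto (fun δ : ℝ => δ ^ 2 * w δ) (𝓝[≠] 0) (𝓝 0) := by
    simpa using hsq.mul hw
  have hexp : Tendsto (fun δ : ℝ => Real.exp (δ ^ 2 * w δ)) (𝓝[≠] 0) (𝓝 1) := by
    have := (Real.continuous_exp.tendsto 0).comp hx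
    simpa [Function.comp_def] using this
  -- the entropy bound rewritten
  have hs' : ∀ᶠ δ in 𝓝[≠] (0 : ℝ), s δ ≤ δ ^ 2 * w δ := by
    filter_upwards [hs, hI] with δ hδ hδI
    obtain ⟨⟨hlo, hhi⟩, hne⟩ := hδI
    have h₁ : T - δ / 2 ≠ 0 := by intro h; linarith
    have h₂ : T + δ / 2 ≠ 0 := by intro h; linarith
    have h₃ : T ^ 2 - δ ^ 2 / 4 ≠ 0 := by
      have : T ^ 2 - δ ^ 2 / 4 = (T - δ / 2) * (T + δ / 2) := by ring
      rw [this]; exact mul_ne_zero h₁ h₂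
    have e : m δ / t * (1 / (T - δ / 2) - 1 / (T + δ / 2)) * t + K * δ ^ 2 = δ ^ 2 * w δ := by
      rw [inv_sub_inv_temperatures h₁ h₂, hw_def]
      field_simp
    linarith [hδ, e.le, e.ge]
  -- the chain of inequalities at each δ, divided by δ²
  have hev : ∀ᶠ δ in 𝓝[≠] (0 : ℝ),
      (m δ / δ) ^ 2 ≤ 1 / 2 * v δ * (w δ * Real.exp (δ ^ 2 * w δ)) := by
    filter_upwards [hHVV, hv0, hs', hI] with δ h1 h2 h3 hδI
    obtain ⟨-, hne⟩ := hδI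
    have hδ2 : 0 < δ ^ 2 := by positivity
    have h4 : Real.exp (s δ) - 1 ≤ Real.exp (δ ^ 2 * w δ) - 1 := by
      linarith [Real.exp_le_exp.mpr h3]
    have h5 : Real.exp (δ ^ 2 * w δ) - 1 ≤ δ ^ 2 * w δ * Real.exp (δ ^ 2 * w δ) :=
      exp_sub_one_le_mul_exp _
    have h6 : m δ ^ 2 ≤ 1 / 2 * v δ * (δ ^ 2 * w δ * Real.exp (δ ^ 2 * w δ)) := by
      have := mul_le_mul_of_nonneg_left (h4.trans h5) (by positivity : (0 : ℝ) ≤ 1 / 2 * v δ)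
      exact h1.trans this
    rw [div_pow, div_le_iff₀ hδ2]
    calc m δ ^ 2 ≤ 1 / 2 * v δ * (δ ^ 2 * w δ * Real.exp (δ ^ 2 * w δ)) := h6
      _ = 1 / 2 * v δ * (w δ * Real.exp (δ ^ 2 * w δ)) * δ ^ 2 := by ring
  have hL : Tendsto (fun δ => (m δ / δ) ^ 2) (𝓝[≠] 0) (𝓝 ((G * t) ^ 2)) := hm.pow 2
  have hR : Tendsto (fun δ => 1 / 2 * v δ * (w δ * Real.exp (δ ^ 2 * w δ))) (𝓝[≠] 0)
      (𝓝 (1 / 2 * V * ((G * t / T ^ 2 + K) * 1))) :=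
    (tendsto_const_nhds.mul hv).mul (hw.mul hexp)
  have key : (G * t) ^ 2 ≤ 1 / 2 * V * ((G * t / T ^ 2 + K) * 1) :=
    le_of_tendsto_of_tendsto hL hR hev
  nlinarith [key]

/-! ## Proved glue, part 2: what weak-NESS uniqueness (U) gives for free, from the tree -/

/-- **NESS facts from the tree, under (U).** For `N ≥ 2` and `T_L, T_R > 0` the member `μ N T_L T_R` of a
steady-state family is: a probability measure, INVARIANT under the constructed transition kernels
(`transitionKernel`), integrates `e^{ϑH}` for some `ϑ > 0`, and is absolutely continuous w.r.t. Lebesgue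
measure — because the Krylov–Bogoliubov invariant measure of `pinnedChainSemigroup`
(`pinnedChainSemigroup_exists_isInvariant_of_pos`, PROVED) is a weak steady state
(`pinnedChain_isSteadyState_of_isInvariant`) and (U) identifies it with `μ N T_L T_R`; absolute continuity by
`pinnedChain_transitionKernel_one_absolutelyContinuous` + `IsInvariant.absolutelyContinuous_of_kernel`. -/
theorem ness_facts {ω₂ lam β γ : ℝ} (hω : 0 < ω₂) (hl : 0 < lam) (hβ : 0 < β) (hγ : 0 < γ)
    (huniq : ∀ (N : ℕ) (T_L T_R : ℝ), 0 < T_L → 0 < T_R → ∀ μ ν : Measure (PhaseSpace N),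
      (pinnedChain ω₂ lam β γ).IsSteadyState N T_L T_R μ →
      (pinnedChain ω₂ lam β γ).IsSteadyState N T_L T_R ν → μ = ν)
    (μ : (N : ℕ) → ℝ → ℝ → Measure (PhaseSpace N))
    (hμ : ∀ (N : ℕ) (T_L T_R : ℝ), 0 < T_L → 0 < T_R →
      (pinnedChain ω₂ lam β γ).IsSteadyState N T_L T_R (μ N T_L T_R))
    {N : ℕ} (hN : 2 ≤ N) {T_L T_R : ℝ} (hL : 0 < T_L) (hR : 0 < T_R) :
    IsProbabilityMeasure (μ N T_L T_R) ∧
      (∀ u : ℝ≥0, (μ N T_L T_R).bind ((pinnedChain ω₂ lam β γ).transitionKernel N T_L T_R u) = μ N T_L T_R) ∧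
      (∃ ϑ : ℝ, 0 < ϑ ∧
        Integrable (fun x => Real.exp (ϑ * (pinnedChain ω₂ lam β γ).hamiltonian N x)) (μ N T_L T_R)) ∧
      μ N T_L T_R ≪ (volume : Measure (PhaseSpace N)) := by
  have hN1 : 1 < N := by omega
  obtain ⟨ν, hνP, hinv, hint⟩ := pinnedChainSemigroup_exists_isInvariant_of_pos hω hl hβ hγ hN1 hL hR
  have hmax : 0 < max T_L T_R := lt_max_of_lt_left hL
  have hϑ0 : 0 < 1 / max T_L T_R / 2 := by positivity
  have hϑ1 : 1 / max T_L T_R / 2 < 1 / max T_L T_R := half_lt_self (by positivity)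
  have hνss : (pinnedChain ω₂ lam β γ).IsSteadyState N T_L T_R ν :=
    pinnedChain_isSteadyState_of_isInvariant hω.le hl.le hβ.le γ N _ hinv hϑ0 (hint _ hϑ0 hϑ1)
  have hμν : μ N T_L T_R = ν := huniq N T_L T_R hL hR _ _ (hμ N T_L T_R hL hR) hνss
  rw [hμν]
  refine ⟨hνP, fun u => hinv u, ⟨_, hϑ0, hint _ hϑ0 hϑ1⟩, ?_⟩
  refine hinv.absolutelyContinuous_of_kernel _ 1 fun z => ?_
  rw [pinnedChainSemigroup_kernel]
  exact pinnedChain_transitionKernel_one_absolutelyContinuous hω hl.le hβ.le hγ.le N T_L T_R hγ hL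
    (by omega) z

/-! ## The composition: the six stubs conclude the crux BY NAME (real proof, no `sorry`) -/

/-- **`LinearResponseFTUR` from the six stubs.** Clause (a): `stub_localClausius` (fed with
`stub_countingFieldDB`) at `T ± δ/2` for every bond index, summed: `δ · totalCurrent(μ_δ) ≥ 0`, so
`totalCurrent/δ ≥ 0` eventually and `D_N ≥ 0` in the limit. Clause (b): at each small `δ ≠ 0` the crux's own
hypothesis `KL ≤ Kδ²` makes `KL < ∞`, `ness_facts` + `stub_finiteEntropy` discharge the hypotheses of
`stub_stationaryFTUR` (fed with `stub_countingFieldDB`), which gives HVV with `⟨Q_t⟩ = tJ_b(δ)` and exponent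
`tJ_b(δ)(1/T_R-1/T_L) + KL`; `stub_equalBondCurrents` turns `J_b(δ)/δ` into `totalCurrent/((N-1)δ) → G`;
`stub_varianceLimit` gives `Var_δ → V_N(b,t)`; `KL.toReal ≤ Kδ²`; then `shape_pointwise_of_hvv_family`. -/
theorem LinearResponseFTUR_of :
    Registered.stub_countingFieldDB → Registered.stub_stationaryFTUR → Registered.stub_finiteEntropy →
      Registered.stub_equalBondCurrents → Registered.stub_varianceLimit → Registered.stub_localClausius →
      Summit.AtomisticToContinuum.FouriersLaw.Theses.BondHeatUncertainty.LinearResponseFTUR := by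
  intro hDB hFT hEnt hEq hVar hCl
  have hFT' : StationaryFTUR := hFT hDB
  have hCl' : SecondLawAtFiniteBias := hCl hDB
  intro ω₂ lam β γ hω hl hβ hγ huniq μ hμ T hT D hD
  intro P C V N hN
  have hN1 : (0 : ℝ) < (N : ℝ) - 1 := by
    have : (2 : ℝ) ≤ (N : ℝ) := by exact_mod_cast hN
    linarith
  have hsmall := eventually_small_bias hT
  refine ⟨?_, ?_⟩
  · ------------------------------------------------------------------ clause (a)
    have hev : ∀ᶠ δ in 𝓝[≠] (0 : ℝ), 0 ≤ P.totalCurrent (μ N (T + δ / 2) (T - δ / 2)) / δ := by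
      filter_upwards [hsmall] with δ hδ
      obtain ⟨⟨⟨hlo, hhi⟩, hne⟩, ha, hb⟩ := hδ
      have hsl := hCl' ω₂ lam β γ hω hl hβ hγ huniq μ hμ N (T + δ / 2) (T - δ / 2) ha hb
      have h₁ : T - δ / 2 ≠ 0 := hb.ne'
      have h₂ : T + δ / 2 ≠ 0 := ha.ne'
      have hpos : 0 < T ^ 2 - δ ^ 2 / 4 := by
        have : T ^ 2 - δ ^ 2 / 4 = (T - δ / 2) * (T + δ / 2) := by ring
        rw [this]; exact mul_pos hb ha
      have hsum : 0 ≤ (1 / (T - δ / 2) - 1 / (T + δ / 2)) *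
          P.totalCurrent (μ N (T + δ / 2) (T - δ / 2)) := by
        show 0 ≤ (1 / (T - δ / 2) - 1 / (T + δ / 2)) *
          ∑ i : Fin N, ∫ x, P.bondCurrent N i x ∂(μ N (T + δ / 2) (T - δ / 2))
        rw [Finset.mul_sum]
        exact Finset.sum_nonneg fun i _ => hsl i
      rw [inv_sub_inv_temperatures h₁ h₂] at hsum
      set J := P.totalCurrent (μ N (T + δ / 2) (T - δ / 2)) with hJ
      have h1 : 0 ≤ δ * J := by
        have := mul_nonneg hsum hpos.le
        have e : δ / (T ^ 2 - δ ^ 2 / 4) * J * (T ^ 2 - δ ^ 2 / 4) = δ * J := by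
          rw [mul_right_comm, div_mul_cancel₀ δ hpos.ne']
        linarith [this, e.le, e.ge]
      have e2 : δ * J / δ ^ 2 = J / δ := by
        rw [pow_two, mul_div_mul_left J δ hne]
      rw [← e2]
      exact div_nonneg h1 (sq_nonneg δ)
    exact ge_of_tendsto (hD N) hev
  · ------------------------------------------------------------------ clause (b)
    intro b hb t ht K hK hKL
    -- the bond-current observable of the crux's `C` and the stubs
    set jf : PhaseSpace N → ℝ := fun x => if h : b < N then P.bondCurrent N ⟨b, h⟩ x else 0 with hjf
    -- everything that holds at each small δ ≠ 0
    have hE : ∀ᶠ δ in 𝓝[≠] (0 : ℝ),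
        ((δ ∈ Set.Ioo (-T) T ∧ δ ≠ 0) ∧ 0 < T + δ / 2 ∧ 0 < T - δ / 2) ∧
        (∫ p, (fun p : PhaseSpace N × WienerPair =>
            ∫ s in (0 : ℝ)..t, jf (P.solMap N (T + δ / 2) (T - δ / 2) s p.1 (pairPath p.2))) p
            ∂((μ N (T + δ / 2) (T - δ / 2)).prod wienerPair) =
          t * ∫ x, jf x ∂(μ N (T + δ / 2) (T - δ / 2))) ∧
        ((∫ p, (fun p : PhaseSpace N × WienerPair =>
            ∫ s in (0 : ℝ)..t, jf (P.solMap N (T + δ / 2) (T - δ / 2) s p.1 (pairPath p.2))) p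
            ∂((μ N (T + δ / 2) (T - δ / 2)).prod wienerPair)) ^ 2 ≤
          1 / 2 * variance (fun p : PhaseSpace N × WienerPair =>
            ∫ s in (0 : ℝ)..t, jf (P.solMap N (T + δ / 2) (T - δ / 2) s p.1 (pairPath p.2)))
            ((μ N (T + δ / 2) (T - δ / 2)).prod wienerPair) *
          (Real.exp (t * (∫ x, jf x ∂(μ N (T + δ / 2) (T - δ / 2))) *
              (1 / (T - δ / 2) - 1 / (T + δ / 2)) +
            (InformationTheory.klDiv (μ N (T + δ / 2) (T - δ / 2))
              ((μ N (T + δ / 2) (T - δ / 2)).map fun x : PhaseSpace N => (x.1, -x.2))).toReal) - 1)) ∧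
        (∫ x, jf x ∂(μ N (T + δ / 2) (T - δ / 2)) =
          P.totalCurrent (μ N (T + δ / 2) (T - δ / 2)) / ((N : ℝ) - 1)) ∧
        ((InformationTheory.klDiv (μ N (T + δ / 2) (T - δ / 2))
            ((μ N (T + δ / 2) (T - δ / 2)).map fun x : PhaseSpace N => (x.1, -x.2))).toReal ≤
          K * δ ^ 2) := by
      filter_upwards [hsmall, hKL] with δ hδ hKLδ
      obtain ⟨-, ha, hb'⟩ := id hδ
      obtain ⟨hprob, hinv, hexp, hac⟩ := ness_facts hω hl hβ hγ huniq μ hμ hN ha hb'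
      have hent := hEnt ω₂ lam β γ hω hl hβ hγ (T + δ / 2) (T - δ / 2) ha hb' N hN
        (μ N (T + δ / 2) (T - δ / 2)) hprob hinv hexp
      have hKLne : InformationTheory.klDiv (μ N (T + δ / 2) (T - δ / 2))
          ((μ N (T + δ / 2) (T - δ / 2)).map fun x : PhaseSpace N => (x.1, -x.2)) ≠ ⊤ :=
        ne_top_of_le_ne_top ENNReal.ofReal_ne_top hKLδ
      have hft := hFT' ω₂ lam β γ hω hl hβ hγ (T + δ / 2) (T - δ / 2) ha hb' N b hb
        (μ N (T + δ / 2) (T - δ / 2)) hprob hinv hexp hac hent hKLne t ht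
      have heq := hEq ω₂ lam β γ hω hl hβ hγ (T + δ / 2) (T - δ / 2) ha hb' N
        (μ N (T + δ / 2) (T - δ / 2)) (hμ N _ _ ha hb') hexp b hb
      refine ⟨hδ, hft.1, hft.2, heq, ?_⟩
      exact ENNReal.toReal_le_of_le_ofReal (by positivity) hKLδ
    -- the five inputs of the bookkeeping certificate
    refine shape_pointwise_of_hvv_family
      (m := fun δ => ∫ p, (fun p : PhaseSpace N × WienerPair =>
            ∫ s in (0 : ℝ)..t, jf (P.solMap N (T + δ / 2) (T - δ / 2) s p.1 (pairPath p.2))) p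
            ∂((μ N (T + δ / 2) (T - δ / 2)).prod wienerPair))
      (v := fun δ => variance (fun p : PhaseSpace N × WienerPair =>
            ∫ s in (0 : ℝ)..t, jf (P.solMap N (T + δ / 2) (T - δ / 2) s p.1 (pairPath p.2)))
            ((μ N (T + δ / 2) (T - δ / 2)).prod wienerPair))
      (s := fun δ => t * (∫ x, jf x ∂(μ N (T + δ / 2) (T - δ / 2))) *
              (1 / (T - δ / 2) - 1 / (T + δ / 2)) +
            (InformationTheory.klDiv (μ N (T + δ / 2) (T - δ / 2))
              ((μ N (T + δ / 2) (T - δ / 2)).map fun x : PhaseSpace N => (x.1, -x.2))).toReal)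
      (G := D N / ((N : ℝ) - 1)) (K := K) (V := V N b t) ht hT ?_ ?_ ?_ ?_ ?_
    · -- HVV at each small δ
      exact hE.mono fun δ h => h.2.2.1
    · -- variances are nonnegative
      exact Eventually.of_forall fun δ => variance_nonneg _ _
    · -- the mean: m δ / δ = t · totalCurrent/((N-1)δ) → t G
      have hlim : Tendsto (fun δ : ℝ =>
          t * (P.totalCurrent (μ N (T + δ / 2) (T - δ / 2)) / δ / ((N : ℝ) - 1)))
          (𝓝[≠] 0) (𝓝 (t * (D N / ((N : ℝ) - 1)))) :=
        ((hD N).div_const ((N : ℝ) - 1)).const_mul t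
      have hlim' : Tendsto (fun δ : ℝ =>
          t * (P.totalCurrent (μ N (T + δ / 2) (T - δ / 2)) / δ / ((N : ℝ) - 1)))
          (𝓝[≠] 0) (𝓝 (D N / ((N : ℝ) - 1) * t)) := by
        convert hlim using 2; ring
      refine hlim'.congr' ?_
      filter_upwards [hE] with δ hδ
      obtain ⟨⟨⟨-, hne⟩, -, -⟩, hmean, -, heq, -⟩ := hδ
      rw [hmean, heq]
      field_simp
    · -- δ-continuity of the variance
      exact hVar ω₂ lam β γ hω hl hβ hγ huniq μ hμ T hT N hN b hb t ht
    · -- the entropy balance with the snapshot bound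
      filter_upwards [hE] with δ hδ
      obtain ⟨⟨⟨-, hne⟩, -, -⟩, hmean, -, -, hkl⟩ := hδ
      rw [hmean]
      have e : t * (∫ x, jf x ∂(μ N (T + δ / 2) (T - δ / 2))) / t *
          (1 / (T - δ / 2) - 1 / (T + δ / 2)) * t =
          t * (∫ x, jf x ∂(μ N (T + δ / 2) (T - δ / 2))) * (1 / (T - δ / 2) - 1 / (T + δ / 2)) := by
        field_simp
      rw [e]
      linarith

end Summit.AtomisticToContinuum.FouriersLaw.Cruxes.LinearResponseFTUR.CountingFieldDetailedBalance

end
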